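import Summits.KontsevichZagierPeriods.KontsevichZagierPeriods.Theses.SpheresForWalls

/-!
# `SphericalKernel` (stmt-KontsevichZagierPeriods-16458, route SpheresForWalls, rank 5) — birth skeleton

Crux (THE CORE of the route, conjecture-grade): for every pinned disc padding `P`
(`P n r = [{z₀² + z₁² ≤ 1} × σ, f ∘ tail²]`, twist `T = FreeAbelianGroup.lift (of ∘ P)` = multiplication
by `[π]`), every `ℤ`-combination `c` of SPHERICAL representations (domain all of `ℝ^{2m}`, density
analytic on `(S²)^m`, i.e. analytic everywhere and again analytic after inverting any sub-family of the
`m` coordinate planes), of ANY dimensions `2m`, with `KZ.eval c = 0` has a twist `T^[N] c ∈ KZ.relations`.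

Line `birth` = the route's own TWO-LAYER PLAN for its core ("SphericalKernel ⇐ layer by `m`") made
into a checked skeleton, with the seam the plan leaves implicit typed as its own stub. The twist `T`
is UNIFORM over the terms of a combination, so it never aligns sphere counts: a vanishing combination
mixing `(S²)^m` and `(S²)^{m'}` (e.g. `4·[S², ω₂] − [(S²)², ω₄]`, both sides `π²`, when the polar-curve
1-period of `ω₂` is `π/4 = arctan 1`) stays mixed after every twist. Hence the core splits as

* `stub_pureSphericalKernel` (OPEN CORE, per sphere count `m`): a vanishing combination of spherical
  representations ALL of dimension `2m` has a twist in `KZ.relations` — Kontsevich's formal period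
  conjecture for the single closed pair `((ℙ¹×ℙ¹)^m ∖ D, [(S²)^m])` (exactness + functoriality, no
  boundary relator; `m = 0`: null combinations of constants; `m = 1` ⊇ the route's decided layer
  `RationalSphereLayer`, Huber–Wüstholz territory). Implied by the crux (`AddSubgroup.closure_mono`).
* `stub_gradedDescent` (OPEN, the cross-layer seam): a vanishing MIXED combination is, after a twist
  and modulo the moves, a finite sum of vanishing PURE combinations — every coincidence between closed
  periods on different numbers of spheres is explained through pure ones (weights: a period of
  `(S²)^m` has weights in `[2m, 4m]`; overlaps between layers are the `π^k ×` lower-layer values).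
  Implied by the crux (empty family); does not give the crux without the pure layers.
* `stub_twistPreservesRelations` (provable now, size S/M): `T` maps `KZ.relations` into itself for the
  pinned padding — the in-tree left-ideal theorem `KZ.piRep_mul_mem_relations` (KZProductIdeal)
  transported from `[π] * ·` (disc in coordinates `0,1` of `Fin (2 + n)`) to the P-form (`Fin (n + 2)`)
  along the reindexing move `KZ.IntegralRep.of_sub_of_reindex_mem_relations` and `IntegralRep.ext'`.
  It is what lets twists taken at different stages be merged (the route's `closes` avoids it by
  peeling with PiCancellation; a skeleton of THIS crux may not borrow another crux).

Composition (sorry-free, below): `SphericalKernel_of : ⟨stub₁⟩ → ⟨stub₂⟩ → ⟨stub₃⟩ → SphericalKernel`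
— descend (`stub_gradedDescent`) to `T^[N] c ≡ d₁ + … + d_k` with `d_j` pure and vanishing, twist each
`d_j` into `relations` (`stub_pureSphericalKernel`), and merge the exponents by induction on the list
using `T(relations) ⊆ relations` (`stub_twistPreservesRelations`): `T^[N + ΣN_j] c ∈ relations`. The
leaf `sphericalKernel_of_stubs : SphericalKernel` feeds the three stubs in BY NAME.

Disproof used: none on file (the crux directory `Cruxes/SphericalKernel/` was empty at registration —
no `Disproof.lean`, no ideas, no lines, no dead lines; `ledger negatives --problem
KontsevichZagierPeriods` has one entry, KinematicPlaneConvex, unrelated to any stub).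

BC3 (registrar's probes, `bc/SphericalKernel_probes_*.lean` of the registrar seat; table
`BC3-TABLE.md` next to this file): for each stub, `stub → SphericalKernel` and
`stub → KontsevichZagierPeriods` by `first | exact? | simpa | aesop` (and each tactic alone, and after
`unfold`) FAIL — no stub is cheaply the crux or the summit.
-/

set_option linter.dupNamespace false

noncomputable section

namespace Summit.KontsevichZagierPeriods.KontsevichZagierPeriods.Cruxes.SphericalKernel.Birth

open Summit.KontsevichZagierPeriods.KontsevichZagierPeriods.Theses.SpheresForWalls (SphericalKernel)

/-! ## The three stubs -/

/-- Stub 1 — PURE-LAYER SPHERICAL KERNEL (the open core, one sphere count at a time). For every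
pinned disc padding `P` and every `m`: a `ℤ`-combination `c` of spherical representations ALL of
dimension `2m` (domain `ℝ^{2m}`, density analytic on `(S²)^m` — the chart condition spelled out inline
exactly as in the crux) with `KZ.eval c = 0` has a twist `T^[N] c ∈ KZ.relations`,
`T = FreeAbelianGroup.lift (of ∘ P)`. This is Kontsevich's formal period conjecture for the ONE closed
real pair `((ℙ¹×ℙ¹)^m ∖ D, [(S²)^m])` (relators: exactness — a move by the route's WallFreeExactness —
and functoriality along finite Nash correspondences — sheet transfer, rules 1–2; no boundary
relator), `π`-localised. Layers: `m = 0` = null combinations of constants (provable now); `m = 1`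
⊇ the route's `RationalSphereLayer` (values `π ×` 1-periods of the polar curves, decided by
Huber–Wüstholz 2022 Thm 13.3); `m = 2` ∋ `π²ζ(2)`-type values. Why plausibly true: implied by the crux
(`AddSubgroup.closure_mono`), hence by AyoubPiLocalKernel (stmt-0541) and by the summit. Why it might
fail: as the crux — a vanishing `⟨[(S²)^m], ω⟩` not explained by exactness + correspondences would
refute Kontsevich's formal conjecture (barrier `kzConjecture_implies_oddZetaAlgIndep` applies from
`m = 2` on). Sources: KontsevichZagier2001 §1.2/§4.1; HuberMullerStachPeriods2017 Conj. 13.2.1;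
Hörmann arXiv:2106.03803 Thm 1.2; HuberWustholz2022 Thm 13.3; Ayoub2014 Conj. 7. Size: open-problem
(per layer; `m = 0` S, `m = 1` XL). -/
theorem stub_pureSphericalKernel : let Sph : (m : ℕ) → Literature.NumberTheory.Transcendental.KZ.IntegralRep (m * 2) → Prop := (fun (m : ℕ) (R : Literature.NumberTheory.Transcendental.KZ.IntegralRep (m * 2)) => R.domain = Set.univ ∧ ∀ ε : Fin m → Bool, ∃ K : (Fin (m * 2) → ℝ) → ℝ, (∀ w, AnalyticAt ℝ K w) ∧ ∀ w : Fin (m * 2) → ℝ, (∀ k : Fin m, ε k = true → w (finProdFinEquiv (k, (0 : Fin 2))) ^ 2 + w (finProdFinEquiv (k, (1 : Fin 2))) ^ 2 ≠ 0) → K w = R.integrand (fun i : Fin (m * 2) => if ε (finProdFinEquiv.symm i).1 = true then w i / (w (finProdFinEquiv ((finProdFinEquiv.symm i).1, (0 : Fin 2))) ^ 2 + w (finProdFinEquiv ((finProdFinEquiv.symm i).1, (1 : Fin 2))) ^ 2) else w i) * ∏ k : Fin m, (if ε k = true then ((w (finProdFinEquiv (k, (0 : Fin 2))) ^ 2 +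 w (finProdFinEquiv (k, (1 : Fin 2))) ^ 2)⁻¹) ^ 2 else 1)); ∀ (P : ∀ n : ℕ, Literature.NumberTheory.Transcendental.KZ.IntegralRep n → Literature.NumberTheory.Transcendental.KZ.IntegralRep (n + 2)), (∀ (n : ℕ) (r : Literature.NumberTheory.Transcendental.KZ.IntegralRep n), (P n r).domain = {z : Fin (n + 2) → ℝ | z 0 ^ 2 + z 1 ^ 2 ≤ 1 ∧ (fun i : Fin n => z i.succ.succ) ∈ r.domain} ∧ (P n r).integrand = fun z => r.integrand (fun i : Fin n => z i.succ.succ)) → ∀ (m : ℕ) (c : Literature.NumberTheory.Transcendental.KZ.FormalRep), c ∈ AddSubgroup.closure {x : Literature.NumberTheory.Transcendental.KZ.FormalRep | ∃ R : Literature.NumberTheory.Transcendental.KZ.IntegralRep (m * 2), Sph m R ∧ x = Literature.NumberTheory.Transcendental.KZ.of R} → Literature.NumberTheory.Transcendental.KZ.eval c = 0 → ∃ N : ℕ, (⇑(FreeAbelianGroup.lift (fun s : (Σ n, Literature.NumberTheory.Transcendental.KZ.IntegralRep n) => Literature.NumberTheory.Transcendental.KZ.of (P s.1 s.2))))^[N]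 c ∈ Literature.NumberTheory.Transcendental.KZ.relations := by
  sorry

/-- Stub 2 — GRADED DESCENT (the cross-layer seam). For every pinned disc padding `P`: a
`ℤ`-combination `c` of spherical representations of ARBITRARY dimensions with `KZ.eval c = 0` is,
after a twist and modulo the moves, a finite sum of PURE vanishing combinations: there are `N`, and a
list `d₁, …, d_k`, each `d_j` a combination of spherical representations of a single dimension `2m_j`
with `KZ.eval d_j = 0`, such that `T^[N] c − (d₁ + … + d_k) ∈ KZ.relations`. Content: the twist is
uniform over the terms of `c`, so sphere counts are never aligned by twisting; every coincidence of
closed periods ACROSS sphere counts (e.g. `4·[S², ω₂] = [(S²)², ω₄] = π²` when the polar-curve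
1-period of `ω₂` is `arctan 1 = π/4`) must be resolved through the moves into coincidences WITHIN
layers (weight bookkeeping: periods of `(S²)^m` have weights in `[2m, 4m]`, and the overlap of layers
`m < m'` consists of `π^{m'-m} ×` layer-`m` values up to the formal period conjecture). Why plausibly
true: implied by the crux (take the empty list), hence by stmt-0541 and the summit; strictly weaker
than the crux (it does not touch the pure layers). Why it might fail: only with the summit; the
informative failure is a cross-layer identity whose every move-resolution passes through a non-pure
vanishing combination of bounded twist — none is known. Sources: KontsevichZagier2001 §1.2;
DeligneHodgeII1971 (weights); HuberMullerStachPeriods2017 §13.1; arXiv:2106.03803. Size: open-problem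
(lighter than Stub 1: a normal-form statement, attackable layer-pair by layer-pair, first case
`m = 1` vs `m' = 2` with `ω₂` rational). -/
theorem stub_gradedDescent : let Sph : (m : ℕ) → Literature.NumberTheory.Transcendental.KZ.IntegralRep (m * 2) → Prop := (fun (m : ℕ) (R : Literature.NumberTheory.Transcendental.KZ.IntegralRep (m * 2)) => R.domain = Set.univ ∧ ∀ ε : Fin m → Bool, ∃ K : (Fin (m * 2) → ℝ) → ℝ, (∀ w, AnalyticAt ℝ K w) ∧ ∀ w : Fin (m * 2) → ℝ, (∀ k : Fin m, ε k = true → w (finProdFinEquiv (k, (0 : Fin 2))) ^ 2 + w (finProdFinEquiv (k, (1 : Fin 2))) ^ 2 ≠ 0) → K w = R.integrand (fun i : Fin (m * 2) => if ε (finProdFinEquiv.symm i).1 = true then w i / (w (finProdFinEquiv ((finProdFinEquiv.symm i).1, (0 : Fin 2))) ^ 2 + w (finProdFinEquiv ((finProdFinEquiv.symm i).1, (1 : Fin 2))) ^ 2) else w i) * ∏ k : Fin m, (if ε k = true then ((w (finProdFinEquiv (k, (0 : Fin 2))) ^ 2 + w (finProdFinEquiv (k, (1 : Fin 2))) ^ 2)⁻¹)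 ^ 2 else 1)); ∀ (P : ∀ n : ℕ, Literature.NumberTheory.Transcendental.KZ.IntegralRep n → Literature.NumberTheory.Transcendental.KZ.IntegralRep (n + 2)), (∀ (n : ℕ) (r : Literature.NumberTheory.Transcendental.KZ.IntegralRep n), (P n r).domain = {z : Fin (n + 2) → ℝ | z 0 ^ 2 + z 1 ^ 2 ≤ 1 ∧ (fun i : Fin n => z i.succ.succ) ∈ r.domain} ∧ (P n r).integrand = fun z => r.integrand (fun i : Fin n => z i.succ.succ)) → ∀ c : Literature.NumberTheory.Transcendental.KZ.FormalRep, c ∈ AddSubgroup.closure {x : Literature.NumberTheory.Transcendental.KZ.FormalRep | ∃ (m : ℕ) (R : Literature.NumberTheory.Transcendental.KZ.IntegralRep (m * 2)), Sph m R ∧ x = Literature.NumberTheory.Transcendental.KZ.of R} → Literature.NumberTheory.Transcendental.KZ.eval c = 0 → ∃ (N : ℕ) (l : List Literature.NumberTheory.Transcendental.KZ.FormalRep), (∀ d ∈ l, (∃ m : ℕ, d ∈ AddSubgroup.closure {x : Literature.NumberTheory.Transcendental.KZ.FormalRep | ∃ R : Literature.NumberTheory.Transcendental.KZ.IntegralRep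 (m * 2), Sph m R ∧ x = Literature.NumberTheory.Transcendental.KZ.of R}) ∧ Literature.NumberTheory.Transcendental.KZ.eval d = 0) ∧ (⇑(FreeAbelianGroup.lift (fun s : (Σ n, Literature.NumberTheory.Transcendental.KZ.IntegralRep n) => Literature.NumberTheory.Transcendental.KZ.of (P s.1 s.2))))^[N] c - l.sum ∈ Literature.NumberTheory.Transcendental.KZ.relations := by
  sorry

/-- Stub 3 — THE TWIST PRESERVES THE MOVES (provable now). For every pinned disc padding `P`,
`T = FreeAbelianGroup.lift (of ∘ P)` maps `KZ.relations` into itself: padding a move by the closed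
unit disc in two NEW FRONT coordinates is again a move (domain/integrand additivity: products with the
disc; change of variables: `Φ̃ (z₀, z₁, x) = (z₀, z₁, Φ x)`, same Jacobian; Newton–Leibniz: the last
coordinate stays last, primitive `F ∘ tail²`). In the tree this is the left-ideal theorem
`Literature.NumberTheory.Transcendental.KZ.piRep_mul_mem_relations` (KZProductIdeal.lean; `[π] * ·`
with the disc in the first block of `Fin (2 + n)`), to be transported to the pinned P-form
(`Fin (n + 2)`, `P n r = (piRep.prod r).reindex (finCongr (Nat.add_comm 2 n))` by `IntegralRep.ext'`)
along the reindexing move `KZ.IntegralRep.of_sub_of_reindex_mem_relations`: `T x − [π] * x ∈ relations`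
for every `x` (induction on the free abelian group), and `[π] * relations ⊆ relations`. Why it might
fail: it does not (Lean-side bookkeeping only: `Fin (2 + n)` vs `Fin (n + 2)` casts). Sources:
KontsevichZagier2001 §1.2; tree KZProductIdeal (`piRep_mul_mem_relations`,
`of_sub_of_reindex_mem_relations`). Size S/M. -/
theorem stub_twistPreservesRelations : ∀ (P : ∀ n : ℕ, Literature.NumberTheory.Transcendental.KZ.IntegralRep n → Literature.NumberTheory.Transcendental.KZ.IntegralRep (n + 2)), (∀ (n : ℕ) (r : Literature.NumberTheory.Transcendental.KZ.IntegralRep n), (P n r).domain = {z : Fin (n + 2) → ℝ | z 0 ^ 2 + z 1 ^ 2 ≤ 1 ∧ (fun i : Fin n => z i.succ.succ) ∈ r.domain} ∧ (P n r).integrand = fun z => r.integrand (fun i : Fin n => z i.succ.succ)) → ∀ x : Literature.NumberTheory.Transcendental.KZ.FormalRep, x ∈ Literature.NumberTheory.Transcendental.KZ.relations → FreeAbelianGroup.lift (fun s : (Σ n, Literature.NumberTheory.Transcendental.KZ.IntegralRep n) => Literature.NumberTheory.Transcendental.KZ.of (P s.1 s.2)) x ∈ Literature.NumberTheory.Transcendental.KZ.relations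 := by
  sorry

/-! ## Composition (sorry-free) -/

open Literature.NumberTheory.Transcendental

/-- Iterates of an additive endomorphism that preserves a subgroup preserve it. [folklore] -/
theorem iterate_mem_of_forall_mem {T : KZ.FormalRep →+ KZ.FormalRep} {S : AddSubgroup KZ.FormalRep}
    (hT : ∀ x ∈ S, T x ∈ S) : ∀ (k : ℕ) (x : KZ.FormalRep), x ∈ S → (⇑T)^[k] x ∈ S := by
  intro k
  induction k with
  | zero => intro x hx; simpa using hx
  | succ k ih =>
    intro x hx
    rw [Function.iterate_succ_apply']
    exact hT _ (ih x hx)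

/-- Iterates of an additive endomorphism are additive. [folklore] -/
theorem iterate_map_add (T : KZ.FormalRep →+ KZ.FormalRep) :
    ∀ (k : ℕ) (a b : KZ.FormalRep), (⇑T)^[k] (a + b) = (⇑T)^[k] a + (⇑T)^[k] b := by
  intro k
  induction k with
  | zero => intro a b; rfl
  | succ k ih =>
    intro a b
    rw [Function.iterate_succ_apply', Function.iterate_succ_apply', Function.iterate_succ_apply', ih,
      map_add]

/-- MERGING THE EXPONENTS. If `T` preserves `KZ.relations`, every member of a list `l` has a twist in
`KZ.relations`, and some twist of `x − l.sum` lies in `KZ.relations`, then some twist of `x` lies in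
`KZ.relations` (induction on the list; the exponents add up). [cite: KontsevichZagier2001, §1.2] -/
theorem exists_iterate_mem_of_list {T : KZ.FormalRep →+ KZ.FormalRep}
    (hT : ∀ x ∈ KZ.relations, T x ∈ KZ.relations) :
    ∀ (l : List KZ.FormalRep) (x : KZ.FormalRep),
      (∀ d ∈ l, ∃ N : ℕ, (⇑T)^[N] d ∈ KZ.relations) →
      (∃ N : ℕ, (⇑T)^[N] (x - l.sum) ∈ KZ.relations) →
      ∃ N : ℕ, (⇑T)^[N] x ∈ KZ.relations := by
  intro l
  induction l with
  | nil =>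
    intro x _ hx
    simpa using hx
  | cons d l ih =>
    intro x hl hx
    obtain ⟨Nd, hNd⟩ := hl d (by simp)
    have hx' : ∃ N : ℕ, (⇑T)^[N] ((x - d) - l.sum) ∈ KZ.relations := by
      obtain ⟨N, hN⟩ := hx
      refine ⟨N, ?_⟩
      have hs : x - (d :: l).sum = (x - d) - l.sum := by
        rw [List.sum_cons]
        abel
      rw [← hs]
      exact hN
    obtain ⟨N₁, hN₁⟩ := ih (x - d) (fun e he => hl e (List.mem_cons_of_mem d he)) hx'
    refine ⟨Nd + N₁, ?_⟩
    have hsplit : (⇑T)^[Nd + N₁] x = (⇑T)^[Nd + N₁] (x - d) + (⇑T)^[Nd + N₁] d := by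
      rw [← iterate_map_add]
      congr 1
      abel
    rw [hsplit]
    refine KZ.relations.add_mem ?_ ?_
    · rw [Function.iterate_add_apply]
      exact iterate_mem_of_forall_mem hT Nd _ hN₁
    · rw [Nat.add_comm, Function.iterate_add_apply]
      exact iterate_mem_of_forall_mem hT N₁ _ hNd

/-- **The skeleton theorem.** PURE-LAYER KERNEL → GRADED DESCENT → TWIST PRESERVES THE MOVES →
`SphericalKernel` (concluded BY NAME): descend a vanishing mixed combination to a sum of vanishing pure
ones after a twist, twist each pure piece into `relations`, and merge the exponents.
[cite: KontsevichZagier2001, §1.2 Conjecture 1] -/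
theorem SphericalKernel_of :
    (let Sph : (m : ℕ) → Literature.NumberTheory.Transcendental.KZ.IntegralRep (m * 2) → Prop := (fun (m : ℕ) (R : Literature.NumberTheory.Transcendental.KZ.IntegralRep (m * 2)) => R.domain = Set.univ ∧ ∀ ε : Fin m → Bool, ∃ K : (Fin (m * 2) → ℝ) → ℝ, (∀ w, AnalyticAt ℝ K w) ∧ ∀ w : Fin (m * 2) → ℝ, (∀ k : Fin m, ε k = true → w (finProdFinEquiv (k, (0 : Fin 2))) ^ 2 + w (finProdFinEquiv (k, (1 : Fin 2))) ^ 2 ≠ 0) → K w = R.integrand (fun i : Fin (m * 2) => if ε (finProdFinEquiv.symm i).1 = true then w i / (w (finProdFinEquiv ((finProdFinEquiv.symm i).1, (0 : Fin 2))) ^ 2 + w (finProdFinEquiv ((finProdFinEquiv.symm i).1, (1 : Fin 2))) ^ 2) else w i) * ∏ k : Fin m, (if ε k = true then ((w (finProdFinEquiv (k, (0 : Fin 2))) ^ 2 + w (finProdFinEquiv (k, (1 : Fin 2))) ^ 2)⁻¹) ^ 2 else 1)); ∀ (P : ∀ n : ℕ, Literature.NumberTheory.Transcendental.KZ.IntegralRep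 n → Literature.NumberTheory.Transcendental.KZ.IntegralRep (n + 2)), (∀ (n : ℕ) (r : Literature.NumberTheory.Transcendental.KZ.IntegralRep n), (P n r).domain = {z : Fin (n + 2) → ℝ | z 0 ^ 2 + z 1 ^ 2 ≤ 1 ∧ (fun i : Fin n => z i.succ.succ) ∈ r.domain} ∧ (P n r).integrand = fun z => r.integrand (fun i : Fin n => z i.succ.succ)) → ∀ (m : ℕ) (c : Literature.NumberTheory.Transcendental.KZ.FormalRep), c ∈ AddSubgroup.closure {x : Literature.NumberTheory.Transcendental.KZ.FormalRep | ∃ R : Literature.NumberTheory.Transcendental.KZ.IntegralRep (m * 2), Sph m R ∧ x = Literature.NumberTheory.Transcendental.KZ.of R} → Literature.NumberTheory.Transcendental.KZ.eval c = 0 → ∃ N : ℕ, (⇑(FreeAbelianGroup.lift (fun s : (Σ n, Literature.NumberTheory.Transcendental.KZ.IntegralRep n) => Literature.NumberTheory.Transcendental.KZ.of (P s.1 s.2))))^[N] c ∈ Literature.NumberTheory.Transcendental.KZ.relations) →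
    (let Sph : (m : ℕ) → Literature.NumberTheory.Transcendental.KZ.IntegralRep (m * 2) → Prop := (fun (m : ℕ) (R : Literature.NumberTheory.Transcendental.KZ.IntegralRep (m * 2)) => R.domain = Set.univ ∧ ∀ ε : Fin m → Bool, ∃ K : (Fin (m * 2) → ℝ) → ℝ, (∀ w, AnalyticAt ℝ K w) ∧ ∀ w : Fin (m * 2) → ℝ, (∀ k : Fin m, ε k = true → w (finProdFinEquiv (k, (0 : Fin 2))) ^ 2 + w (finProdFinEquiv (k, (1 : Fin 2))) ^ 2 ≠ 0) → K w = R.integrand (fun i : Fin (m * 2) => if ε (finProdFinEquiv.symm i).1 = true then w i / (w (finProdFinEquiv ((finProdFinEquiv.symm i).1, (0 : Fin 2))) ^ 2 + w (finProdFinEquiv ((finProdFinEquiv.symm i).1, (1 : Fin 2))) ^ 2) else w i) * ∏ k : Fin m, (if ε k = true then ((w (finProdFinEquiv (k, (0 : Fin 2))) ^ 2 + w (finProdFinEquiv (k, (1 : Fin 2))) ^ 2)⁻¹) ^ 2 else 1)); ∀ (P : ∀ n : ℕ, Literature.NumberTheory.Transcendental.KZ.IntegralRep n → Literature.NumberTheory.Transcendental.KZ.IntegralRep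 (n + 2)), (∀ (n : ℕ) (r : Literature.NumberTheory.Transcendental.KZ.IntegralRep n), (P n r).domain = {z : Fin (n + 2) → ℝ | z 0 ^ 2 + z 1 ^ 2 ≤ 1 ∧ (fun i : Fin n => z i.succ.succ) ∈ r.domain} ∧ (P n r).integrand = fun z => r.integrand (fun i : Fin n => z i.succ.succ)) → ∀ c : Literature.NumberTheory.Transcendental.KZ.FormalRep, c ∈ AddSubgroup.closure {x : Literature.NumberTheory.Transcendental.KZ.FormalRep | ∃ (m : ℕ) (R : Literature.NumberTheory.Transcendental.KZ.IntegralRep (m * 2)), Sph m R ∧ x = Literature.NumberTheory.Transcendental.KZ.of R} → Literature.NumberTheory.Transcendental.KZ.eval c = 0 → ∃ (N : ℕ) (l : List Literature.NumberTheory.Transcendental.KZ.FormalRep), (∀ d ∈ l, (∃ m : ℕ, d ∈ AddSubgroup.closure {x : Literature.NumberTheory.Transcendental.KZ.FormalRep | ∃ R : Literature.NumberTheory.Transcendental.KZ.IntegralRep (m * 2), Sph m R ∧ x = Literature.NumberTheory.Transcendental.KZ.of R}) ∧ Literature.NumberTheory.Transcendental.KZ.eval d = 0) ∧ (⇑(FreeAbelianGroup.lift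 (fun s : (Σ n, Literature.NumberTheory.Transcendental.KZ.IntegralRep n) => Literature.NumberTheory.Transcendental.KZ.of (P s.1 s.2))))^[N] c - l.sum ∈ Literature.NumberTheory.Transcendental.KZ.relations) →
    (∀ (P : ∀ n : ℕ, Literature.NumberTheory.Transcendental.KZ.IntegralRep n → Literature.NumberTheory.Transcendental.KZ.IntegralRep (n + 2)), (∀ (n : ℕ) (r : Literature.NumberTheory.Transcendental.KZ.IntegralRep n), (P n r).domain = {z : Fin (n + 2) → ℝ | z 0 ^ 2 + z 1 ^ 2 ≤ 1 ∧ (fun i : Fin n => z i.succ.succ) ∈ r.domain} ∧ (P n r).integrand = fun z => r.integrand (fun i : Fin n => z i.succ.succ)) → ∀ x : Literature.NumberTheory.Transcendental.KZ.FormalRep, x ∈ Literature.NumberTheory.Transcendental.KZ.relations → FreeAbelianGroup.lift (fun s : (Σ n, Literature.NumberTheory.Transcendental.KZ.IntegralRep n) => Literature.NumberTheory.Transcendental.KZ.of (P s.1 s.2)) x ∈ Literature.NumberTheory.Transcendental.KZ.relations) →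
    SphericalKernel := by
  intro h1 h2 h3 P hP c hc h0
  obtain ⟨N, l, hl, hrel⟩ := h2 P hP c hc h0
  have hT : ∀ x ∈ KZ.relations,
      (FreeAbelianGroup.lift (fun s : (Σ n, KZ.IntegralRep n) => KZ.of (P s.1 s.2))) x ∈ KZ.relations :=
    h3 P hP
  have hmem : ∀ d ∈ l, ∃ N' : ℕ,
      (⇑(FreeAbelianGroup.lift (fun s : (Σ n, KZ.IntegralRep n) => KZ.of (P s.1 s.2))))^[N'] d ∈
        KZ.relations := by
    intro d hd
    obtain ⟨⟨m, hdm⟩, hd0⟩ := hl d hd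
    exact h1 P hP m d hdm hd0
  obtain ⟨N', hN'⟩ := exists_iterate_mem_of_list hT l _ hmem ⟨0, by simpa using hrel⟩
  exact ⟨N' + N, by rw [Function.iterate_add_apply]; exact hN'⟩

/-- The leaf from the registered stubs: the three stubs compose ON THE NOSE to the crux
(`SphericalKernel_of` fed with `stub_pureSphericalKernel`, `stub_gradedDescent`,
`stub_twistPreservesRelations` by name; sorries enter only through the stubs). -/
theorem sphericalKernel_of_stubs : SphericalKernel :=
  SphericalKernel_of stub_pureSphericalKernel stub_gradedDescent stub_twistPreservesRelations

end Summit.KontsevichZagierPeriods.KontsevichZagierPeriods.Cruxes.SphericalKernel.Birth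

end
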